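import Summits.QuantumFields.YangMills.Theorems.BalabanUVNodesN15TwoSpacingGluingNeumannKnitNode
import Summits.QuantumFields.YangMills.Theorems.BalabanUVNodesN15TwoSpacingGluingRecordKnitLetters
import HarnessLib

/-!
# THE GLUING STEP AT TWO LATTICE SPACINGS, LXXII: FILE 50's SOCKET CALLED FOR THE RECORD COVER's GLUED PAIR ON THE TORUS OF RECORD — `NE2PlusOperator` BY NAME ON THE REALISED FAMILY
# `knitInstanceR ∕ knitFamilyR`, `(gf i).M := L^s` LIVE, THE VOLUME `m_T` FREE, MODULO THE ENTRY-3 PAIR (dag-n15-c g14, FILE 115 = 93R; N15 = NE2, s1 «background-layer OPERATOR ingredient»)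

Cell `pub-ymgap`, seat `pub-ymgap-dag-n15-c` (R134 (a); HUMAN RULING D-0062), generation 14.  `bears_on: R4∕N15 · K3⁸ SpineGivenEndpointR13SepCoPHV (stmt-QuantumFields-27366)`.
Filed `--supports stmt-QuantumFields-27366 --as helper` — COUNT-NEUTRAL.  Definitions (the record index, its carrier, realised instance and kernel family — the record twins of FILE 93's) and
theorems; 0 `sorry`.  Imports BY NAME FILE 93 `…NeumannKnitNode` (FILE 50 `ne2PlusOperator_glued_of_letters` ∕ `gluedOps`, n15-b's `bgInstance` ∕ `coeffBg` ∕ `fineGeo` ∕ `bgPairing` ∕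
`opFamily`, the carrier lemmas) and FILE 114 `…RecordKnitLetters` (★★★ `gluedLetters_knitR_of_entryThree`); nothing in the tree is modified.

WHAT.  §1 `KnitIdxR` (index `(s, m_T, K, r; μ, ν)` with `s + 1 ≤ m_T`, `K ≥ 1`, `4 ≤ L^K`), `knitTorR` (the torus of record `MP (paramsOf d L m_T K hL)`), `knitGeoR` (the SIZED carrier, size
parameter `M = L^s`), `KnitXR ∕ KnitXR'`, `knitBlkR`, `knitPrR`, `knitInstanceR` (`(gf i).M = L^s` by `rfl`: `knitInstanceR_gf_M`; unbounded over the family: `knitInstanceR_gf_M_unbounded` — for every `M₅`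
an index with `L^s ≥ M₅`, volume `m_T := s + 1`), `knitFamilyR` (FILE 50's `gluedOps` of the RECORD cover's parametrix pair: lifted cubes `knitGR`, partition `knitHR`).  §2 ★★★
**`ne2PlusOperator_knitR_of_entryThree`**: `d ≥ 1`, odd `L ≥ 3`, `a > 0`, any `c₃₅ θc θ`; under the two entry-3 binders (dag-n15-w5's 86R∕88R shapes) ⟹ `NE2PlusOperator c₃₅ (knitInstanceR hL θc θ)
(knitFamilyR hL a θc θ)` — THE SOCKET OF RECORD for the glued `U ≡ 1` pair: the torus `2L^{m_T}` is FREE of the cube scale `L^s`, `M = L^s` is LIVE and unbounded over the family.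

HONEST FRAMING ∕ LIMITS.  Block-majorant bookkeeping over LANDED rows + FILE 50's socket; `U ≡ 1` MODEL of [B6] §2's machine on the torus of record (cube letters from each cube's own doubled
torus via programme P: not circular in the volume); the predicate `NE2PlusOperator` is the tree's HYPOTHESIS SHAPE, NOT [B9]'s printed statement (no `Q(U)`, the entries do not depend on `U`);
constants crude and ours; nothing of [B5]∕[B6] (2.38)–(2.40)∕[B9] Thm 3.1, 3.14 asserted.  NE2⁺ AS PRINTED is NOT proved; N15 NOT discharged; counts of record UNMOVED (typed 28∕28 · discharged
5∕27); one finite 𝕋⁴ at fixed ε per index — NOT infinite volume (each index is a finite torus; «volume free» = uniform in the finite volume), NOT OS on ℝ⁴, NOT a mass gap, NOT Clay; R4 closes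
`BalabanLadder.UV` only.  Restate-immune (no Theses import).
-/

noncomputable section

namespace Summit.QuantumFields.YangMills.BalabanUVNodes.N15.Gluing

open Real
open Literature.MathematicalPhysics.QuantumFieldTheory.Balaban1983to89
open Literature.MathematicalPhysics.QuantumFieldTheory.Balaban1983to89.B5Prop11Plancherel (Tor fine)
open Literature.MathematicalPhysics.QuantumFieldTheory.Balaban1983to89.B11SectG (BlockNorm HasMaj RowSum)
open Literature.MathematicalPhysics.QuantumFieldTheory.Balaban1983to89.T4EtaRate (PairedInstance EtaPairing NE2PlusOperator)
open Literature.MathematicalPhysics.QuantumFieldTheory.Balaban1983to89.T4EtaRateDefect (idef rateWeight)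
open Literature.MathematicalPhysics.QuantumFieldTheory.Balaban1983to89.T4EtaRateCoeffDefect (pull)
open Literature.MathematicalPhysics.QuantumFieldTheory.Balaban1983to89.B6UnitTorusCarrier (unitTorusGeo triangle254_unitTorusGeo rowSum_unitTorusGeo unitTorusGeo_dist_self
  unitTorusGeo_len)
open Literature.MathematicalPhysics.QuantumFieldTheory.Balaban1983to89.B5SiteBridgeP12 (MP)
open Literature.MathematicalPhysics.QuantumFieldTheory.King1986.Torus (blockOf tdistT tdistT_nonneg)
open Summit.QuantumFields.YangMills.BalabanUVNodes.N15.VectorPiece (bshiftEquiv kingPrV blkFine unitTorusGeoS)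
open Summit.QuantumFields.YangMills.BalabanUVNodes.N15.BackgroundLayer (fgrad fgradAdj coeffBg fineGeo bgPairing bgInstance)
open Summit.QuantumFields.YangMills.BalabanUVNodes.N15.OperatorReadout (opGeo opFamily realisedInstance)
open Summit.QuantumFields.YangMills.BalabanUVNodes.N15.TwoGrid (paramsOf deltaOp)

/-! ## §1 The index and the realised family of the cover's glued pair -/

section Family

/-- THE INDEX of the RECORD cover's glued family: cube scale `s` (LIFTED cubes of side `L^{s+1}` on the torus of record `2L^{m_T}`; [B9] size parameter `M = L^s`), the VOLUME exponent
`m_T ≥ s + 1` (free), the coarse run's `K ≥ 1` scales with `4 ≤ L^K`, the fine run's extra `r` scales, and the directions `μ`, `ν` of entries 1 and 2.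
[cite: Balaban1985BackgroundPropagators, Thm 3.1 p.397 («for M ≥ M₁»: the size parameter)] -/
structure KnitIdxR (d L : ℕ) : Type where
  /-- cube scale: lifted cubes of side `L^{s+1}`, size parameter `M = L^s` -/
  s : ℕ
  /-- volume exponent: the torus of record `2L^{m_T}` -/
  mT : ℕ
  /-- number of scales of the coarse run -/
  K : ℕ
  /-- extra scales of the fine run -/
  r : ℕ
  /-- the cubes fit: `s + 1 ≤ m_T` -/
  hs : s + 1 ≤ mT
  /-- `K ≥ 1` -/
  one_le : 1 ≤ K
  /-- `4 ≤ L^K` -/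
  four_le : 4 ≤ L ^ K
  /-- direction of entry 1 -/
  μ : Fin (d + 1)
  /-- direction of entry 2 -/
  ν : Fin (d + 1)

variable {d : ℕ} {L : ℕ} [NeZero L]

/-- The torus of record `2L^{m_T}` of the index (dag-n15-a's `MP (paramsOf d L m_T K hL)`). [folklore] -/
abbrev knitTorR (hL : Odd L ∧ 1 < L) (i : KnitIdxR d L) : Fin (d + 1) → ℕ := MP (paramsOf d L i.mT i.K hL)

/-- THE SIZED [B6] CARRIER of the index: the unit-torus carrier of the torus of record with size parameter `M = L^s`. [cite: Balaban1985BackgroundPropagators, Thm 3.1 p.397 (the size parameter)] -/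
abbrev knitGeoR (hL : Odd L ∧ 1 < L) (i : KnitIdxR d L) : B6.Geometry := unitTorusGeoS L i.K (knitTorR hL i) ((L : ℝ) ^ i.s)

/-- The coarse bond lattice (spacing `L^{−k}`). [folklore] -/
abbrev KnitXR (hL : Odd L ∧ 1 < L) (i : KnitIdxR d L) : Type := Tor (fine (L ^ i.K) (knitTorR hL i)) × Fin (d + 1)

/-- The fine bond lattice (spacing `L^{−(k+r)}`). [folklore] -/
abbrev KnitXR' (hL : Odd L ∧ 1 < L) (i : KnitIdxR d L) : Type := Tor (fine (L ^ i.r * L ^ i.K) (knitTorR hL i)) × Fin (d + 1)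

/-- The coarse block map (unit blocks). [folklore] -/
abbrev knitBlkR (hL : Odd L ∧ 1 < L) (i : KnitIdxR d L) : KnitXR hL i → (knitGeoR hL i).Site := blkFine L i.K (knitTorR hL i)

/-- King's pairing of fine bonds with coarse bonds. [cite: King1986, p.664 (convention before Prop. 3.8)] -/
abbrev knitPrR (hL : Odd L ∧ 1 < L) (i : KnitIdxR d L) : KnitXR' hL i → KnitXR hL i := kingPrV L i.K i.r (knitTorR hL i)

/-- `L ≠ 0` on the carrier. [folklore] -/
theorem knitGeoR_L_ne_zero (hL : Odd L ∧ 1 < L) (i : KnitIdxR d L) : (knitGeoR hL i).L ≠ 0 := Nat.cast_ne_zero.mpr (NeZero.ne L)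

/-- THE REALISED PAIRED INSTANCE of the record index: n15-b's `bgInstance` over the sized carrier (coefficient carriers `coeffBg` with the index's `M = L^s`, King's pairing, scale shift `r`).
[cite: Balaban1985BackgroundPropagators, Thm 3.14 pp.426–427 (typing template); (3.35) p.396] -/
def knitInstanceR (hL : Odd L ∧ 1 < L) (θc θ : ℝ) (i : KnitIdxR d L) : PairedInstance :=
  bgInstance (g := knitGeoR hL i) (knitBlkR hL i) (knitPrR hL i) i.r (knitGeoR_L_ne_zero hL i) θc θ

/-- **THE GUARD IS LIVE**: the fine realised instance's [B9] size parameter IS `L^s`. [folklore] -/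
theorem knitInstanceR_gf_M (hL : Odd L ∧ 1 < L) (θc θ : ℝ) (i : KnitIdxR d L) : (knitInstanceR hL θc θ i).gf.M = (L : ℝ) ^ i.s := rfl

/-- There is NO bounded-`M` witness on the family once one index exists at every `s` (given `K` with `4 ≤ L^K`; volume `m_T := s + 1`): `L^s` is unbounded (`L ≥ 2`). [folklore] -/
theorem knitInstanceR_gf_M_unbounded (hL : Odd L ∧ 1 < L) (θc θ : ℝ) {K : ℕ} (hK : 1 ≤ K) (h4 : 4 ≤ L ^ K) (M₅ : ℝ) :
    ∃ i : KnitIdxR d L, M₅ ≤ (knitInstanceR hL θc θ i).gf.M := by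
  obtain ⟨s, hm⟩ := pow_unbounded_of_one_lt M₅ (by exact_mod_cast hL.2 : (1 : ℝ) < (L : ℝ))
  exact ⟨⟨s, s + 1, K, 0, le_rfl, hK, h4, 0, 0⟩, hm.le⟩

/-- THE KERNEL FAMILY of the record index: FILE 50's `gluedOps` of the RECORD cover's parametrix pair (lifted cubes `knitGR`, partition `knitHR`) at the two spacings — `G₀ = Σ_k M_{h_k}G(□_k)M_{h_k}`, `R = −Σ_k[Δ_a, M_{h_k}]G(□_k)M_{h_k}`, `R̃` its
adjoint arrangement, `D = ∇_μ`, `D₃ = Δ`, `E = ∇*_ν` — read through n15-b's `opFamily`; the entries do not depend on the fine configuration (glued `U ≡ 1` family).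
[cite: Balaban1984PropagatorsII, (2.133)–(2.136) p.247 (shapes); Balaban1985BackgroundPropagators, (3.42) p.397 (the four entries: shape)] -/
def knitFamilyR (hL : Odd L ∧ 1 < L) (a θc θ : ℝ) (i : KnitIdxR d L) : B9.KernelFamily (knitInstanceR hL θc θ i).gc (knitInstanceR hL θc θ i).Bf :=
  opFamily (knitBlkR hL i) (knitBlkR hL i ∘ knitPrR hL i) (fun k _ =>
    gluedOps (knitPrR hL i)
      (parametrix (knitHR d L i.s i.mT i.K (L ^ i.K) hL) (knitGR d L i.s i.mT i.K (L ^ i.K) hL i.hs a))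
      (remainder (deltaOp (knitTorR hL i) (L ^ i.K) a) (knitHR d L i.s i.mT i.K (L ^ i.K) hL) (knitGR d L i.s i.mT i.K (L ^ i.K) hL i.hs a))
      (remainderL (deltaOp (knitTorR hL i) (L ^ i.K) a) (knitHR d L i.s i.mT i.K (L ^ i.K) hL) (knitGR d L i.s i.mT i.K (L ^ i.K) hL i.hs a))
      (fgrad ((L ^ i.K : ℕ) : ℝ) (bshiftEquiv (knitTorR hL i) (L ^ i.K) i.μ))
      (lapOp ((L ^ i.K : ℕ) : ℝ) (bshiftEquiv (knitTorR hL i) (L ^ i.K)) 0)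
      (fgradAdj ((L ^ i.K : ℕ) : ℝ) (bshiftEquiv (knitTorR hL i) (L ^ i.K) i.ν))
      (parametrix (knitHR d L i.s i.mT i.K (L ^ i.r * L ^ i.K) hL) (knitGR d L i.s i.mT i.K (L ^ i.r * L ^ i.K) hL i.hs a))
      (remainder (deltaOp (knitTorR hL i) (L ^ i.r * L ^ i.K) a) (knitHR d L i.s i.mT i.K (L ^ i.r * L ^ i.K) hL) (knitGR d L i.s i.mT i.K (L ^ i.r * L ^ i.K) hL i.hs a))
      (remainderL (deltaOp (knitTorR hL i) (L ^ i.r * L ^ i.K) a) (knitHR d L i.s i.mT i.K (L ^ i.r * L ^ i.K) hL) (knitGR d L i.s i.mT i.K (L ^ i.r * L ^ i.K) hL i.hs a))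
      (fgrad ((L ^ i.r * L ^ i.K : ℕ) : ℝ) (bshiftEquiv (knitTorR hL i) (L ^ i.r * L ^ i.K) i.μ))
      (lapOp ((L ^ i.r * L ^ i.K : ℕ) : ℝ) (bshiftEquiv (knitTorR hL i) (L ^ i.r * L ^ i.K)) 0)
      (fgradAdj ((L ^ i.r * L ^ i.K : ℕ) : ℝ) (bshiftEquiv (knitTorR hL i) (L ^ i.r * L ^ i.K) i.ν)) k)

end Family

/-! ## §2 The socket call on the torus of record, modulo the entry-3 pair -/

section Node

variable {d : ℕ} {L : ℕ} [NeZero L]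

/-- ★★★ **NE2⁺, OPERATOR LAYER, BY NAME, FOR THE RECORD COVER's GLUED PAIR ON THE TORUS OF RECORD — `(gf i).M := L^s` LIVE, THE VOLUME `m_T` FREE — MODULO THE ENTRY-3 PAIR.**
`d ≥ 1`, odd `L ≥ 3`, `a > 0`, any `c₃₅, θc, θ`.  Under the two binders of `gluedLetters_knitR_of_entryThree` (dag-n15-w5's 86R∕88R shapes): `NE2PlusOperator c₃₅ (knitInstanceR hL θc θ)
(knitFamilyR hL a θc θ)` — FILE 50's socket `ne2PlusOperator_glued_of_letters` fed with the record bundle, `θ_i = (L^K)^{−γ}`, row-sum rate `σ = δ∕4` (`rowSum_unitTorusGeo`), `M₅ = 1`,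
`a₀ = 1` (the entries do not depend on `U`: the glued `U ≡ 1` family); the index ranges over ALL volumes `m_T ≥ s + 1` — the torus of record is no longer tied to the cube.
[cite: Balaban1985BackgroundPropagators, Thm 3.1 p.397 (quantifier template «M ≥ M₁ … Mα₀ ≤ a₀»), p.399 (architecture); Balaban1984PropagatorsII, Prop. 2.6 (2.135)–(2.136) p.247
(mechanism); King1986, Prop. 3.9 (3.73) p.665 (rate factor)] -/
theorem ne2PlusOperator_knitR_of_entryThree (hd1 : 1 ≤ d) (hL : Odd L ∧ 1 < L) {a : ℝ} (ha : 0 < a) (c35 θc θ : ℝ)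
    (hE3 : ∃ δ A : ℝ, 0 < δ ∧ 0 < A ∧ ∀ (s mT K r : ℕ) (hs : s + 1 ≤ mT) (_hK : 1 ≤ K),
      HasMaj (BlockNorm.ofBlocks (unitTorusGeo L K (MP (paramsOf d L mT K hL))) (fun i : Tor (fine (L ^ r * L ^ K) (MP (paramsOf d L mT K hL))) × Fin (d + 1) => blockOf (L ^ r * L ^ K) (MP (paramsOf d L mT K hL)) i.1))
        (BlockNorm.ofBlocks (unitTorusGeo L K (MP (paramsOf d L mT K hL))) (fun i : Tor (fine (L ^ r * L ^ K) (MP (paramsOf d L mT K hL))) × Fin (d + 1) => blockOf (L ^ r * L ^ K) (MP (paramsOf d L mT K hL)) i.1))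
        (lapOp ((L ^ r * L ^ K : ℕ) : ℝ) (bshiftEquiv (MP (paramsOf d L mT K hL)) (L ^ r * L ^ K)) 0 ∘ₗ parametrix (knitHR d L s mT K (L ^ r * L ^ K) hL) (knitGR d L s mT K (L ^ r * L ^ K) hL hs a))
        (fun y y' => A * Real.exp (-(δ * tdistT (MP (paramsOf d L mT K hL)) y y'))))
    (hE3d : ∃ δ D : ℝ, 0 < δ ∧ 0 < D ∧ ∀ (s mT K r : ℕ) (hs : s + 1 ≤ mT) (_hK : 1 ≤ K) (_hn4 : 4 ≤ L ^ K),
      HasMaj (BlockNorm.ofBlocks (unitTorusGeo L K (MP (paramsOf d L mT K hL))) (fun b : Tor (fine (L ^ K) (MP (paramsOf d L mT K hL))) × Fin (d + 1) => blockOf (L ^ K) (MP (paramsOf d L mT K hL)) b.1))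
        (BlockNorm.ofBlocks (unitTorusGeo L K (MP (paramsOf d L mT K hL))) (fun i : Tor (fine (L ^ r * L ^ K) (MP (paramsOf d L mT K hL))) × Fin (d + 1) => blockOf (L ^ r * L ^ K) (MP (paramsOf d L mT K hL)) i.1))
        (idef (pull (kingPrV L K r (MP (paramsOf d L mT K hL)))) (pull (kingPrV L K r (MP (paramsOf d L mT K hL))))
          (lapOp ((L ^ r * L ^ K : ℕ) : ℝ) (bshiftEquiv (MP (paramsOf d L mT K hL)) (L ^ r * L ^ K)) 0 ∘ₗ parametrix (knitHR d L s mT K (L ^ r * L ^ K) hL) (knitGR d L s mT K (L ^ r * L ^ K) hL hs a))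
          (lapOp ((L ^ K : ℕ) : ℝ) (bshiftEquiv (MP (paramsOf d L mT K hL)) (L ^ K)) 0 ∘ₗ parametrix (knitHR d L s mT K (L ^ K) hL) (knitGR d L s mT K (L ^ K) hL hs a)))
        (fun y y' => D * ((L ^ K : ℕ) : ℝ) ^ (-(1 / 16 : ℝ)) * Real.exp (-(δ * tdistT (MP (paramsOf d L mT K hL)) y y')))) :
    NE2PlusOperator c35 (knitInstanceR (d := d) hL θc θ) (knitFamilyR (d := d) hL a θc θ) := by
  obtain ⟨δ, A, κ₀, m₀, r₀, γ, hδ, hA, hκ₀, hm₀, hr₀, hγ, H⟩ := gluedLetters_knitR_of_entryThree (d := d) hd1 hL ha hE3 hE3d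
  have hL0 : L ≠ 0 := by have := hL.2; omega
  have hLr : (0 : ℝ) < (L : ℝ) := by exact_mod_cast Nat.pos_of_ne_zero hL0
  have hσ : 0 < δ / 4 := by positivity
  exact ne2PlusOperator_glued_of_letters (fun i => knitGeoR hL i) (KnitXR hL) (KnitXR' hL) (knitBlkR hL) (knitPrR hL)
    (fun i => fineGeo (knitGeoR hL i) (KnitXR' hL i) (knitBlkR hL i ∘ knitPrR hL i) i.r)
    (fun i => coeffBg (fun x : KnitXR hL i => x) (knitGeoR hL i).M θc) (fun i => coeffBg (knitPrR hL i) (knitGeoR hL i).M θ)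
    (fun i => bgPairing (knitBlkR hL i) (knitPrR hL i) i.r (knitGeoR_L_ne_zero hL i) θc θ)
    (fun i _ => parametrix (knitHR d L i.s i.mT i.K (L ^ i.K) hL) (knitGR d L i.s i.mT i.K (L ^ i.K) hL i.hs a))
    (fun i _ => remainder (deltaOp (knitTorR hL i) (L ^ i.K) a) (knitHR d L i.s i.mT i.K (L ^ i.K) hL) (knitGR d L i.s i.mT i.K (L ^ i.K) hL i.hs a))
    (fun i _ => remainderL (deltaOp (knitTorR hL i) (L ^ i.K) a) (knitHR d L i.s i.mT i.K (L ^ i.K) hL) (knitGR d L i.s i.mT i.K (L ^ i.K) hL i.hs a))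
    (fun i _ => fgrad ((L ^ i.K : ℕ) : ℝ) (bshiftEquiv (knitTorR hL i) (L ^ i.K) i.μ))
    (fun i _ => lapOp ((L ^ i.K : ℕ) : ℝ) (bshiftEquiv (knitTorR hL i) (L ^ i.K)) 0)
    (fun i _ => fgradAdj ((L ^ i.K : ℕ) : ℝ) (bshiftEquiv (knitTorR hL i) (L ^ i.K) i.ν))
    (fun i _ => parametrix (knitHR d L i.s i.mT i.K (L ^ i.r * L ^ i.K) hL) (knitGR d L i.s i.mT i.K (L ^ i.r * L ^ i.K) hL i.hs a))
    (fun i _ => remainder (deltaOp (knitTorR hL i) (L ^ i.r * L ^ i.K) a) (knitHR d L i.s i.mT i.K (L ^ i.r * L ^ i.K) hL) (knitGR d L i.s i.mT i.K (L ^ i.r * L ^ i.K) hL i.hs a))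
    (fun i _ => remainderL (deltaOp (knitTorR hL i) (L ^ i.r * L ^ i.K) a) (knitHR d L i.s i.mT i.K (L ^ i.r * L ^ i.K) hL) (knitGR d L i.s i.mT i.K (L ^ i.r * L ^ i.K) hL i.hs a))
    (fun i _ => fgrad ((L ^ i.r * L ^ i.K : ℕ) : ℝ) (bshiftEquiv (knitTorR hL i) (L ^ i.r * L ^ i.K) i.μ))
    (fun i _ => lapOp ((L ^ i.r * L ^ i.K : ℕ) : ℝ) (bshiftEquiv (knitTorR hL i) (L ^ i.r * L ^ i.K)) 0)
    (fun i _ => fgradAdj ((L ^ i.r * L ^ i.K : ℕ) : ℝ) (bshiftEquiv (knitTorR hL i) (L ^ i.r * L ^ i.K) i.ν))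
    c35 (fun i => triangle254_unitTorusGeo L i.K (knitTorR hL i)) (fun i y y' => tdistT_nonneg _ _ _) (fun i y => unitTorusGeo_dist_self L i.K (knitTorR hL i) y)
    (fun i => rowSum_unitTorusGeo L i.K (knitTorR hL i) hσ) hσ.le (B4Sect5Proof.latticeConst_nonneg (d + 1) hσ.le)
    (fun i => inv_pos.mpr (pow_pos hLr _)) (fun i => hLr) (fun i y => (unitTorusGeo_len L i.K (knitTorR hL i) hL0 y).symm.le)
    ⟨1, δ, 1, A, κ₀, m₀, r₀, γ, fun i => ((L : ℝ) ^ i.K) ^ (-γ), one_pos, by linarith, one_pos, hA, hκ₀, hm₀, hr₀, hγ,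
      fun i => Real.rpow_nonneg (pow_nonneg hLr.le _) _, fun i y => le_rfl,
      fun i _ α₀ _ _ U _ => H i.s i.mT i.K i.r i.hs i.one_le i.four_le i.μ i.ν⟩

end Node

end Summit.QuantumFields.YangMills.BalabanUVNodes.N15.Gluing

end
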